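import Summits.QuantumFields.YangMills.Theorems.BalabanUVNodesN07FrakGOfRecordTraceSectors
import HarnessLib

/-!
# NODE N07 — THE SLOT-(c) LETTERS OF def-Y's SCHEME RESPECT THE TRACE SECTORS: print's `π = 1 − DG′RD*`, the pinning projection `proj_{N(Q′♭)ᗮ}` and the concrete `G′` commute with
# the fibrewise scalar part at every `N ≥ 1` (for a commuting `G′`), the slot-(c) Hessian `π†(Δ(U₀) + Δ⁽²⁾)π` does whenever `Δ(U₀)` and `Δ⁽²⁾` do (so at `N = 2` for a commuting `Δ⁽²⁾`),
# and then the slot-(c) `𝒢 = frakGOfRecordAtBg128` maps traceless currents to traceless jets — the trace companion of ✓p822030 §2 ([B9] (3.24)–(3.25) p. 394, (3.119) p. 419,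
# (3.128) p. 421; [15] (110)–(111) p. 294, (116) p. 295, (51) p. 286)

Cell `pub-ymgap`, width seat `pub-ymgap-dag-n07-w3` (g26), CLAIM-22.  `--kind proof --supports stmt-QuantumFields-27238 --as helper`; count-neutral.
[15] = [Balaban1985Variational]; [B9] = [Balaban1985BackgroundPropagators].

CONTENTS (`S := scalPartW N _`; the data letters `G′ =: Gp`, `Δ⁽²⁾ =: Δ2` enter with the DISPLAYED hypotheses «commutes with `S`», as their reality did in ✓p822030).
* §1 `scalPartW_piOfRecord`, `scalPartW_adjoint_piOfRecord`, `scalPartW_mem_ker_QflatOfRecord`, `scalPartW_kerOrthProj` (`proj_{N(Q′♭)ᗮ}`), `scalPartW_printGreenOfRecord` (the concrete `G′`),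
  ★`scalPartW_hessOpOfRecord128` (any `N`, `Δ(U₀)` commuting displayed), `scalPartW_hessOpOfRecord128_two` (`N = 2`).
* §2 ★★`trace_equiv_frakGOfRecordAtBg128_eq_zero` (any `N`, displayed `Δ(U₀)`-commutation), ★★`trace_equiv_frakGOfRecordAtBg128_eq_zero_two` (`N = 2`): the slot-(c) `𝒢`-ROW trace half.

HONEST LABELS.  Linear bookkeeping over ✓`…N07TraceSectorProjection`, ✓`…N07H1OfRecordTraceSectors`, ✓`…N07FrakGOfRecordTraceSectors`; no estimate; the `𝔄`-row (`B(V)` traceless: `tr log = log det`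
on `SU(N)` near `1`), `H♭`∕`H₁` (115) readings, `C^{𝔰𝔩}`, `Emap`∕`W` trace letters still owed.  Count-neutral; N07 NOT discharged; P0 ⟨26900⟩ OPEN; R4 is the conditional finite-𝕋⁴ rung only.
Nothing here is a claim about the Yang–Mills mass gap (`Summit.QuantumFields`): finite torus, fixed `ε`; nothing continuum ∕ OS ∕ Clay.
-/

set_option autoImplicit false

noncomputable section

open scoped Matrix Matrix.Norms.L2Operator InnerProductSpace ComplexConjugate BigOperators

namespace Summit.QuantumFields.YangMills.Theorems.N07SlotCTraceSectors

open Literature.MathematicalPhysics.QuantumFieldTheory.Balaban1983to89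
open Literature.MathematicalPhysics.QuantumFieldTheory.Balaban1983to89.T4Continuum (T4Family)
open T4Continuum BlockAveraging
open Node00
open B9SectCLatticeCarrier (Bond)
open B9Eq311L2Pairing (WL2)
open B11Eq103H1Complex (SiteL2K BondL2K covDerivL2K covDivL2K covLaplaceSiteK greenK)
open B11Eq103H1ComplexReality (greenK_map_comm)
open B11Eq115Space (NegSup NegSize levWeight JetSup)
open B11Eq111FrakG (nabla115)
open Summit.QuantumFields.YangMills.Theorems.N07TraceSectorDefs (scalPartW phiRec_equiv_scalPartW)
open Summit.QuantumFields.YangMills.Theorems.N07TraceSectorProjection (scalPartW_isSymmetric starProjection_map_of_isSymmetric scalPartW_comp_covDerivL2K_ofRecord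
  scalPartW_comp_covDivL2K_ofRecord scalPartW_comp_covLaplaceSiteK_ofRecord scalPartW_comp_RrOfRecord scalPartW_comp_hessOpOfRecord_two)
open Summit.QuantumFields.YangMills.Theorems.N07H1OfRecordTraceSectors (adjoint_map_comm_of_isSymmetric)
open Summit.QuantumFields.YangMills.Theorems.N07FrakGOfRecordTraceSectors (trace_equiv_frakGOfRecordAt_eq_zero)

section SlotC

variable (F : T4Family) (N : ℕ) [NeZero N] {K : ℕ} (k : ℕ) (U₀ : GaugeField (F.P K) 0 (SU N)) [Fact (0 < c0Rec F K k)]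
  {Gp : SiteL2K ℂ (F.P K).d (fun _ => (F.P K).sitesPerDir 0) (c0Rec F K k) (WRec N) →ₗ[ℂ]
    SiteL2K ℂ (F.P K).d (fun _ => (F.P K).sitesPerDir 0) (c0Rec F K k) (WRec N)}
  {Δ2 : BondL2K ℂ (F.P K).d (fun _ => (F.P K).sitesPerDir 0) (c0Rec F K k) (WRec N) →ₗ[ℂ]
    BondL2K ℂ (F.P K).d (fun _ => (F.P K).sitesPerDir 0) (c0Rec F K k) (WRec N)}

/-! ## §1  `π`, `π†`, `proj_{N(Q′♭)ᗮ}`, the concrete `G′`, and `π†(Δ + Δ⁽²⁾)π` -/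

/-- **PRINT'S `π = 1 − D G′ R D*` COMMUTES WITH THE SCALAR PART FOR A COMMUTING `G′`** (at `Q′ := Q′♭`; `D`, `R`, `D*` commute at every `N`).
[cite: Balaban1985BackgroundPropagators, (3.119) p.419; Balaban1985Variational, (51) p.286] -/
theorem scalPartW_piOfRecord (hGp : ∀ s, Gp (scalPartW N _ s) = scalPartW N _ (Gp s))
    (x : BondL2K ℂ (F.P K).d (fun _ => (F.P K).sitesPerDir 0) (c0Rec F K k) (WRec N)) :
    piOfRecord F N k U₀ Gp (QflatOfRecord F N k) (scalPartW N _ x) = scalPartW N _ (piOfRecord F N k U₀ Gp (QflatOfRecord F N k) x) := by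
  have hD : ∀ s : SiteL2K ℂ (F.P K).d (fun _ => (F.P K).sitesPerDir 0) (c0Rec F K k) (WRec N),
      covDerivL2K ℂ (c0Rec F K k) (cRec F K k) (RRec F N U₀) (scalPartW N _ s) = scalPartW N _ (covDerivL2K ℂ (c0Rec F K k) (cRec F K k) (RRec F N U₀) s) :=
    fun s => (LinearMap.congr_fun (scalPartW_comp_covDerivL2K_ofRecord F N K k U₀) s).symm
  have hR : ∀ s : SiteL2K ℂ (F.P K).d (fun _ => (F.P K).sitesPerDir 0) (c0Rec F K k) (WRec N),
      RrOfRecord F N k U₀ (QflatOfRecord F N k) (scalPartW N _ s) = scalPartW N _ (RrOfRecord F N k U₀ (QflatOfRecord F N k) s) :=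
    fun s => (LinearMap.congr_fun (scalPartW_comp_RrOfRecord F N K k U₀) s).symm
  have hDs : ∀ y : BondL2K ℂ (F.P K).d (fun _ => (F.P K).sitesPerDir 0) (c0Rec F K k) (WRec N),
      covDivL2K ℂ (c0Rec F K k) (cRec F K k) (SRec F N U₀) (scalPartW N _ y) = scalPartW N _ (covDivL2K ℂ (c0Rec F K k) (cRec F K k) (SRec F N U₀) y) :=
    fun y => (LinearMap.congr_fun (scalPartW_comp_covDivL2K_ofRecord F N K k U₀) y).symm
  unfold piOfRecord
  simp only [LinearMap.sub_apply, LinearMap.id_apply, LinearMap.comp_apply]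
  rw [hDs, hR, hGp, hD, map_sub]

/-- **`π†` COMMUTES WITH THE SCALAR PART** for a commuting `G′` (`S` symmetric on the bond carrier). [cite: Balaban1985BackgroundPropagators, (3.119) p.419] -/
theorem scalPartW_adjoint_piOfRecord (hGp : ∀ s, Gp (scalPartW N _ s) = scalPartW N _ (Gp s))
    (x : BondL2K ℂ (F.P K).d (fun _ => (F.P K).sitesPerDir 0) (c0Rec F K k) (WRec N)) :
    LinearMap.adjoint (piOfRecord F N k U₀ Gp (QflatOfRecord F N k)) (scalPartW N _ x) =
      scalPartW N _ (LinearMap.adjoint (piOfRecord F N k U₀ Gp (QflatOfRecord F N k)) x) :=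
  adjoint_map_comm_of_isSymmetric _ (scalPartW_isSymmetric N _) (scalPartW_isSymmetric N _) (scalPartW_piOfRecord F N k U₀ hGp) x

omit [NeZero N] in
omit [Fact (0 < c0Rec F K k)] in
/-- **`N(Q′♭)` IS INVARIANT UNDER THE SCALAR PART** (`Q′♭` reads values; the scalar part of `0` is `0`). [cite: Balaban1985BackgroundPropagators, (3.20)–(3.21) p.394] -/
theorem scalPartW_mem_ker_QflatOfRecord {s : SiteL2K ℂ (F.P K).d (fun _ => (F.P K).sitesPerDir 0) (c0Rec F K k) (WRec N)}
    (hs : s ∈ LinearMap.ker (QflatOfRecord F N (K := K) k)) : scalPartW N _ s ∈ LinearMap.ker (QflatOfRecord F N (K := K) k) := by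
  rw [LinearMap.mem_ker] at hs ⊢
  funext y
  have h0 := congrFun hs y
  rw [QflatOfRecord_apply, siteFieldIn_apply, Pi.zero_apply] at h0
  rw [QflatOfRecord_apply, siteFieldIn_apply, phiRec_equiv_scalPartW, Pi.zero_apply, h0, Matrix.trace_zero, mul_zero, zero_smul]

omit [NeZero N] in
/-- **THE PINNING PROJECTION `proj_{N(Q′♭)ᗮ}` COMMUTES WITH THE SCALAR PART** (`N(Q′♭)`, hence `N(Q′♭)ᗮ`, is `S`-invariant; `S` symmetric; ✓`starProjection_map_of_isSymmetric`).
[cite: Balaban1985BackgroundPropagators, (3.24) p.394] -/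
theorem scalPartW_kerOrthProj (s : SiteL2K ℂ (F.P K).d (fun _ => (F.P K).sitesPerDir 0) (c0Rec F K k) (WRec N)) :
    haveI : CompleteSpace ↥(LinearMap.ker (QflatOfRecord F N (K := K) k))ᗮ := FiniteDimensional.complete ℂ _
    (LinearMap.ker (QflatOfRecord F N (K := K) k))ᗮ.starProjection (scalPartW N _ s) =
      scalPartW N _ ((LinearMap.ker (QflatOfRecord F N (K := K) k))ᗮ.starProjection s) := by
  refine starProjection_map_of_isSymmetric _ (scalPartW_isSymmetric N _) (fun u hu => ?_) s
  rw [Submodule.mem_orthogonal'] at hu ⊢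
  intro g hg
  rw [scalPartW_isSymmetric N _ u g]
  exact hu _ (scalPartW_mem_ker_QflatOfRecord F N k hg)

/-- **THE CONCRETE `G′ = (Δ_{U₀} + a′·proj_{N(Q′♭)ᗮ})⁻¹` COMMUTES WITH THE SCALAR PART** (lit ✓`greenK_map_comm`). [cite: Balaban1985BackgroundPropagators, (3.24)–(3.25) p.394] -/
theorem scalPartW_printGreenOfRecord (a' : ℝ)
    (hpos' : haveI : CompleteSpace ↥(LinearMap.ker (QflatOfRecord F N (K := K) k))ᗮ := FiniteDimensional.complete ℂ _
      ∀ x, x ≠ 0 → 0 < RCLike.re ⟪x, (covLaplaceSiteK (c₀ := c0Rec F K k) (cRec F K k) (RRec F N U₀) (SRec F N U₀) +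
      (a' : ℂ) • ((LinearMap.ker (QflatOfRecord F N (K := K) k))ᗮ.starProjection : _ →L[ℂ] _).toLinearMap) x⟫_ℂ)
    (s : SiteL2K ℂ (F.P K).d (fun _ => (F.P K).sitesPerDir 0) (c0Rec F K k) (WRec N)) :
    greenK _ hpos' (scalPartW N _ s) = scalPartW N _ (greenK _ hpos' s) := by
  refine greenK_map_comm hpos' _ (fun x => ?_) s
  have h1 := LinearMap.congr_fun (scalPartW_comp_covLaplaceSiteK_ofRecord F N K k U₀) x
  have h2 := scalPartW_kerOrthProj F N k x
  simp only [LinearMap.add_apply, LinearMap.smul_apply, LinearMap.comp_apply, ContinuousLinearMap.coe_coe, map_add, map_smul] at h1 h2 ⊢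
  rw [← h1, h2]

/-- ★ **THE SLOT-(c) HESSIAN `π†(Δ(U₀) + Δ⁽²⁾)π` COMMUTES WITH THE SCALAR PART** whenever `Δ(U₀)`, `Δ⁽²⁾` and `G′` do (any `N`; `Δ(U₀)` displayed — a theorem at `N = 2`).
[cite: Balaban1985BackgroundPropagators, (3.128) p.421, (3.135) p.422; Balaban1985Variational, (51) p.286] -/
theorem scalPartW_hessOpOfRecord128 (hGp : ∀ s, Gp (scalPartW N _ s) = scalPartW N _ (Gp s))
    (hΔ : ∀ x, hessOpOfRecord F N k U₀ (scalPartW N _ x) = scalPartW N _ (hessOpOfRecord F N k U₀ x))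
    (hΔ2 : ∀ x, Δ2 (scalPartW N _ x) = scalPartW N _ (Δ2 x)) (x : BondL2K ℂ (F.P K).d (fun _ => (F.P K).sitesPerDir 0) (c0Rec F K k) (WRec N)) :
    hessOpOfRecord128 F N k U₀ Gp (QflatOfRecord F N k) Δ2 (scalPartW N _ x) = scalPartW N _ (hessOpOfRecord128 F N k U₀ Gp (QflatOfRecord F N k) Δ2 x) := by
  unfold hessOpOfRecord128
  rw [LinearMap.comp_apply, LinearMap.comp_apply, LinearMap.comp_apply, LinearMap.comp_apply, scalPartW_piOfRecord F N k U₀ hGp, LinearMap.add_apply,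
    LinearMap.add_apply, hΔ, hΔ2, ← map_add, scalPartW_adjoint_piOfRecord F N k U₀ hGp]

end SlotC

/-! ## §2  The slot-(c) `𝒢`-row trace half -/

section FrakG

variable (F : T4Family) (N : ℕ) [NeZero N] {K : ℕ} (k : ℕ) (U₀ : GaugeField (F.P K) 0 (SU N)) [Fact (0 < c0Rec F K k)] [Fact (∀ c, 0 < wBRec F K k c)]
  [Fact (0 < (F.L : ℝ))] [Fact (0 < (F.P K).eta k)] (Ω : ℕ → Set (Site (F.P K) 0))
  {Gp : SiteL2K ℂ (F.P K).d (fun _ => (F.P K).sitesPerDir 0) (c0Rec F K k) (WRec N) →ₗ[ℂ]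
    SiteL2K ℂ (F.P K).d (fun _ => (F.P K).sitesPerDir 0) (c0Rec F K k) (WRec N)}
  {Δ2 : BondL2K ℂ (F.P K).d (fun _ => (F.P K).sitesPerDir 0) (c0Rec F K k) (WRec N) →ₗ[ℂ]
    BondL2K ℂ (F.P K).d (fun _ => (F.P K).sitesPerDir 0) (c0Rec F K k) (WRec N)} {a : ℝ}
  (hposπ : ∀ x, x ≠ 0 → 0 < RCLike.re ⟪x, laplaceAOfRecordAt F N k U₀ (hessOpOfRecord128 F N k U₀ Gp (QflatOfRecord F N k) Δ2)
    (QOfRecord F N k U₀) (QflatOfRecord F N k) a x⟫_ℂ)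

set_option maxRecDepth 16384 in
set_option maxHeartbeats 800000 in
/-- ★★ **SLOT (c): THE JET `𝒢 f = frakGOfRecordAtBg128 … f` OF A TRACELESS CURRENT IS TRACELESS AT EVERY BOND** — for commuting `G′`, `Δ⁽²⁾` and `Δ(U₀)` (displayed; a theorem at `N = 2`), under 35b's guard.
[cite: Balaban1985Variational, (110)–(111) p.294, (116) p.295, (51) p.286; Balaban1985BackgroundPropagators, (3.128) p.421] -/
theorem trace_equiv_frakGOfRecordAtBg128_eq_zero (h : SmallBelow (avOfRecord F N K) k U₀) (hGp : ∀ s, Gp (scalPartW N _ s) = scalPartW N _ (Gp s))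
    (hΔ : ∀ x, hessOpOfRecord F N k U₀ (scalPartW N _ x) = scalPartW N _ (hessOpOfRecord F N k U₀ x))
    (hΔ2 : ∀ x, Δ2 (scalPartW N _ x) = scalPartW N _ (Δ2 x)) (hQ : Function.Surjective (QOfRecord F N k U₀)) {f : NegSizeLit F N K k Ω 3}
    (hf : ∀ b, (NegSup.equiv (levWeight (F.L : ℝ) ((F.P K).eta k) (bondLevLit F Ω k) 3) (Matrix (Fin N) (Fin N) ℂ) f b).trace = 0)
    (b : Bond (F.P K).d (fun _ => (F.P K).sitesPerDir 0)) :
    (JetSup.equiv _ _ (nabla115 ((F.P K).eta k) (unitsOfRecord F N U₀)) (frakGOfRecordAtBg128 F N K k Ω U₀ Gp Δ2 a hposπ hQ f) b).trace = 0 :=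
  trace_equiv_frakGOfRecordAt_eq_zero F N k U₀ Ω (Δ₁ := hessOpOfRecord128 F N k U₀ Gp (QflatOfRecord F N k) Δ2) hposπ h
    (scalPartW_hessOpOfRecord128 F N k U₀ hGp hΔ hΔ2) hQ hf b

end FrakG

section SU2

variable (F : T4Family) {K : ℕ} (k : ℕ) (U₀ : GaugeField (F.P K) 0 (SU 2)) [Fact (0 < c0Rec F K k)] [Fact (∀ c, 0 < wBRec F K k c)]
  [Fact (0 < (F.L : ℝ))] [Fact (0 < (F.P K).eta k)] (Ω : ℕ → Set (Site (F.P K) 0))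
  {Gp : SiteL2K ℂ (F.P K).d (fun _ => (F.P K).sitesPerDir 0) (c0Rec F K k) (WRec 2) →ₗ[ℂ]
    SiteL2K ℂ (F.P K).d (fun _ => (F.P K).sitesPerDir 0) (c0Rec F K k) (WRec 2)}
  {Δ2 : BondL2K ℂ (F.P K).d (fun _ => (F.P K).sitesPerDir 0) (c0Rec F K k) (WRec 2) →ₗ[ℂ]
    BondL2K ℂ (F.P K).d (fun _ => (F.P K).sitesPerDir 0) (c0Rec F K k) (WRec 2)} {a : ℝ}

omit [Fact (∀ c, 0 < wBRec F K k c)] [Fact (0 < (F.L : ℝ))] [Fact (0 < (F.P K).eta k)] in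
/-- **At `N = 2` the slot-(c) Hessian commutes with the scalar part for commuting `G′`, `Δ⁽²⁾`** (✓`scalPartW_comp_hessOpOfRecord_two`). [cite: Balaban1985BackgroundPropagators, (3.128) p.421] -/
theorem scalPartW_hessOpOfRecord128_two (hGp : ∀ s, Gp (scalPartW 2 _ s) = scalPartW 2 _ (Gp s)) (hΔ2 : ∀ x, Δ2 (scalPartW 2 _ x) = scalPartW 2 _ (Δ2 x))
    (x : BondL2K ℂ (F.P K).d (fun _ => (F.P K).sitesPerDir 0) (c0Rec F K k) (WRec 2)) :
    hessOpOfRecord128 F 2 k U₀ Gp (QflatOfRecord F 2 k) Δ2 (scalPartW 2 _ x) = scalPartW 2 _ (hessOpOfRecord128 F 2 k U₀ Gp (QflatOfRecord F 2 k) Δ2 x) := by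
  have hΔ : ∀ y : BondL2K ℂ (F.P K).d (fun _ => (F.P K).sitesPerDir 0) (c0Rec F K k) (WRec 2),
      hessOpOfRecord F 2 k U₀ (scalPartW 2 _ y) = scalPartW 2 _ (hessOpOfRecord F 2 k U₀ y) := fun y => by
    rw [← LinearMap.comp_apply, ← scalPartW_comp_hessOpOfRecord_two F K k U₀, LinearMap.comp_apply]
  exact scalPartW_hessOpOfRecord128 F 2 k U₀ hGp hΔ hΔ2 x

set_option maxRecDepth 16384 in
set_option maxHeartbeats 800000 in
/-- ★★ **SLOT (c), `N = 2`: `𝒢 = frakGOfRecordAtBg128` MAPS TRACELESS CURRENTS TO TRACELESS JETS** for commuting data `G′`, `Δ⁽²⁾`, under 35b's guard — the trace half of the `𝒢`-ROW of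
✓`Node00.BgSchemeChartLie.sol_mem_of_rows` at the scheme of record's own `𝒢`, modulo the displayed data rows. [cite: Balaban1985Variational, (116) p.295, (51) p.286; Balaban1985BackgroundPropagators, (3.128) p.421] -/
theorem trace_equiv_frakGOfRecordAtBg128_eq_zero_two (h : SmallBelow (avOfRecord F 2 K) k U₀) (hGp : ∀ s, Gp (scalPartW 2 _ s) = scalPartW 2 _ (Gp s))
    (hΔ2 : ∀ x, Δ2 (scalPartW 2 _ x) = scalPartW 2 _ (Δ2 x))
    (hposπ : ∀ x, x ≠ 0 → 0 < RCLike.re ⟪x, laplaceAOfRecordAt F 2 k U₀ (hessOpOfRecord128 F 2 k U₀ Gp (QflatOfRecord F 2 k) Δ2)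
      (QOfRecord F 2 k U₀) (QflatOfRecord F 2 k) a x⟫_ℂ)
    (hQ : Function.Surjective (QOfRecord F 2 k U₀)) {f : NegSizeLit F 2 K k Ω 3}
    (hf : ∀ b, (NegSup.equiv (levWeight (F.L : ℝ) ((F.P K).eta k) (bondLevLit F Ω k) 3) (Matrix (Fin 2) (Fin 2) ℂ) f b).trace = 0)
    (b : Bond (F.P K).d (fun _ => (F.P K).sitesPerDir 0)) :
    (JetSup.equiv _ _ (nabla115 ((F.P K).eta k) (unitsOfRecord F 2 U₀)) (frakGOfRecordAtBg128 F 2 K k Ω U₀ Gp Δ2 a hposπ hQ f) b).trace = 0 := by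
  have hΔ : ∀ y : BondL2K ℂ (F.P K).d (fun _ => (F.P K).sitesPerDir 0) (c0Rec F K k) (WRec 2),
      hessOpOfRecord F 2 k U₀ (scalPartW 2 _ y) = scalPartW 2 _ (hessOpOfRecord F 2 k U₀ y) := fun y => by
    rw [← LinearMap.comp_apply, ← scalPartW_comp_hessOpOfRecord_two F K k U₀, LinearMap.comp_apply]
  exact trace_equiv_frakGOfRecordAtBg128_eq_zero F 2 k U₀ Ω hposπ h hGp hΔ hΔ2 hQ hf b

end SU2

end Summit.QuantumFields.YangMills.Theorems.N07SlotCTraceSectors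

end
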